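import Literature.AlgebraicGeometry.Frobenioids.UnitTrivializationPullbacks
import HarnessLib

/-!
# Frobenioids I, Proposition 3.3 (iv): the pull-back clause of the dictionary `C^istr ⇆ C^un-tr`

Mochizuki, *The geometry of Frobenioids I: the general theory*, Kyushu J. Math. **62** (2008)
293–400, Prop. 3.3 (iv) p. 60: "an arrow of `C^un-tr` is a(n) … pull-back morphism … if and only if it
arises from such an arrow of `C^istr`." [cite: MochizukiFrdI2008, Prop. 3.3 (iv) p.60]
Proof-only complement to `UnitTrivializationPullbacks.lean` (seat abc-iut-L1-d5): the class of an arrow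
`a` of `C^istr` is a pull-back morphism of `C^un-tr` iff some representative of the class is a pull-back
morphism of `C` (`⇐`: `isPullbackMorphism_toUntr_of`; `⇒`: a pull-back morphism of `C^un-tr` is an
isomorphism followed by the class of a pull-back morphism of `C`, and isomorphisms of `C^un-tr` lift to
isomorphisms of `C^istr`). No statement of the paper is strengthened; nothing here bears on
[IUTchIII] Cor. 3.12.
-/

namespace Literature.AlgebraicGeometry.Frobenioids

open CategoryTheory Opposite

universe w v v' u u'

namespace PreFrobenioid

variable {D : Type u} [Category.{v} D] {Φ : Dᵒᵖ ⥤ CommMonCat.{w}} {C : Type u'}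
  [Category.{v'} C] {F : C ⥤ ElemFrobenioid Φ}

open PreFrobenioidData (ofFunctor)

/-- **Prop. 3.3 (iv), dictionary, "pull-back morphism"** (direction `C^un-tr ⇒ C^istr`): if the class of `a`
is a pull-back morphism of `C^un-tr`, then some representative of that class is a pull-back morphism of
`C`. [cite: MochizukiFrdI2008, Prop. 3.3 (iv) p.60] -/
theorem exists_rep_isPullbackMorphism_of_toUntr (hF : IsFrobenioid F) {A' A : (ofFunctor Φ F).Istr}
    (a : A' ⟶ A) (h : IsPullbackMorphism (untrFunctor hF) ((ofFunctor Φ F).toUntr.map a)) :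
    ∃ a₁ : A' ⟶ A, (ofFunctor Φ F).toUntr.map a₁ = (ofFunctor Φ F).toUntr.map a ∧
      IsPullbackMorphism F a₁.hom := by
  obtain ⟨P, p, e, hp, he⟩ := exists_iso_comp_toUntr_of_isPullbackMorphism hF _ h
  obtain ⟨d, hd⟩ := (ofFunctor Φ F).toUntr.map_surjective (X := A') (Y := P) e.hom
  haveI : IsIso ((ofFunctor Φ F).toUntr.map d) := by rw [hd]; infer_instance
  haveI : IsIso d := (isIso_toUntr_iff hF d).mp inferInstance
  haveI : IsIso d.hom := (ObjectProperty.isIso_hom_iff d).mpr inferInstance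
  refine ⟨d ≫ p, ?_, IsPullbackMorphism.comp F (isPullbackMorphism_of_isIso F d.hom) hp⟩
  rw [Functor.map_comp, hd]
  exact he.symm

/-- **Prop. 3.3 (iv), dictionary, "pull-back morphism"**, both directions: the class of `a ∈ Arr(C^istr)`
is a pull-back morphism of `C^un-tr` iff it "arises from" a pull-back morphism of `C^istr`, i.e. some
arrow of `C^istr` with the same class is a pull-back morphism of `C`. [cite: MochizukiFrdI2008, Prop. 3.3 (iv) p.60] -/
theorem isPullbackMorphism_toUntr_iff (hF : IsFrobenioid F) {A' A : (ofFunctor Φ F).Istr} (a : A' ⟶ A) :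
    IsPullbackMorphism (untrFunctor hF) ((ofFunctor Φ F).toUntr.map a) ↔
      ∃ a₁ : A' ⟶ A, (ofFunctor Φ F).toUntr.map a₁ = (ofFunctor Φ F).toUntr.map a ∧
        IsPullbackMorphism F a₁.hom := by
  refine ⟨exists_rep_isPullbackMorphism_of_toUntr hF a, ?_⟩
  rintro ⟨a₁, ha₁, h⟩
  rw [← ha₁]
  exact isPullbackMorphism_toUntr_of hF a₁ h

end PreFrobenioid

end Literature.AlgebraicGeometry.Frobenioids
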